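import Mathlib
import HarnessLib
import Literature.Computability.MetaComplexity.NegModqImmunity
import Literature.Computability.MetaComplexity.RazborovSmolenskyPoly
import Summits.QuantumAdvantage.AdviceFreeQNC0.OddPrimeStatements

/-!
# The PHASE-PARITY LAW: a perfect strategy has a phase-parity statistic of `𝔽_p`-degree `> (n-2)/3`

Cell `decomp-qadv`, lens 4 (minimal counterexample / extremal), generation 26, second node (the structure of a
minimal counterexample to the open residual `X = AbsorptionDial.NoPerfectPolyOdd ≡ HardToUnityOdd`).

THE THREE PARITIES. For a strategy `y` and an input `u` put `T(u) = {g : y_g(u) = 1}` (the fired cuts) and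
sort the fired cuts by their PREFIX PHASE `r_g(u) = g + W_g(u) (mod 3)` (`W_g` = `wtPrefix`): `offPhase y s u =
#{g ∈ T(u) : r_g(u) ≢ s}`. Cut `g` is dead at `u` iff `c + g + e_g(u) ≡ 0`, `e_g = |u| + W_g`, i.e. iff
`r_g(u) ≡ -(c + |u|)`; so the number of LIVE fired cuts is `offPhase y s†(u) u` with `s†(u) ≡ -(c + |u|) (mod 3)`
(`ringWinU_iff_offPhase_odd`). Since `Σ_s offPhase y s u = 2·#T(u)` is even, the three numbers
`offPhase y 0 u, offPhase y 1 u, offPhase y 2 u` are never all odd (`exists_offPhase_even`): the sets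
`Z_s = {u : offPhase y s u even}` COVER the cube for EVERY strategy, and a PERFECT strategy (winning at every
input) has `Z_s ∩ {u : |u| ≡ -c-s (mod 3)} = ∅` for each `s` — an AVOIDING COVER of the cube by three sets,
each avoiding one weight class mod 3.

THE IMMUNITY STEP (`no_lowDeg_avoiding_cover`, any field with `3 ≠ 0`, via Beck–Li 2013 Thm 5.2 = the tree's
`eq_zero_of_lowDegOn_of_forall_dvd_hwt`, cited BY NAME): there is no cover of `{0,1}ⁿ` by three sets `Z₀, Z₁, Z₂`
with `Z_s` disjoint from the weight class `r_s (mod 3)` and all three indicators of degree `≤ D` when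
`3D + 2 ≤ n`: a function of degree `≤ D < ⌈n/3⌉` vanishing on a whole weight class mod `3` is identically zero
(the immunity of `¬MOD₃`, `eq_zero_of_lowDeg_vanish_class`), so all three indicators vanish and cover nothing.

THE LAW (`perfect_phaseParity_degree`, every prime `p ≠ 3`, NO degree hypothesis on `y`): if `y` wins the
u-walk game at EVERY input of the board `(n, c)` and `3D + 2 ≤ n`, then for some `s ∈ {0,1,2}` the Boolean
statistic `phaseParEven y s = [offPhase y s · even]` is NOT of `𝔽_p`-degree `≤ D`. At `p = 3` the statement is
false: for the one-shot strategy of `walkEasyThree` (fire cut `0` if `c + |u| ≢ 0`, else cut `1`) the three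
statistics are `[c + |u| ≢ 0]`, `[c + |u| ≡ 0]·(1 - u₀)`, `[c + |u| ≡ 0]·u₀`, of `𝔽₃`-degree `≤ 3`.

WHAT THIS IS / IS NOT. It is an unconditional structural constraint on PERFECT strategies (the objects a
counterexample to `X` consists of): the parity of the fired cuts off one prefix phase must carry linear
`𝔽_p`-degree, for every `p ≠ 3` at once. It does NOT prove `X`: `phaseParEven` is a parity of (polylog-degree
indicator) × (prefix-`MOD 3` indicator) terms and is not itself of low degree. It isolates WHERE the degree of a
perfect strategy must sit (memo NODE-g26 §8) and is the zero-error, all-level-sets form of the cell's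
visit-parity objects (`FeatOfVPE.visitCountIn`: for a fixed firing set `Y`, `offPhase` is `#Y −` a visit count).
Theses-free; no `sorry`; cites Beck–Li BY NAME; no instances, no notation.
-/

set_option autoImplicit false
set_option linter.dupNamespace false

noncomputable section

namespace Summit.QuantumAdvantage.QuantumAdvantage.Theorems.PhaseParity
open Classical
open Finset
open Summit.QuantumAdvantage.AdviceFreeQNC0
open Literature.Computability.MetaComplexity Literature.Computability.MetaComplexity.Smolensky

/-! ### §1 Immunity of a shifted weight class (Beck–Li 2013, Theorem 5.2, by name) -/

section Immunity

variable {F : Type*} [Field F] {n : ℕ}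

/-- **Immunity of one weight class mod 3** (Beck–Li 2013 Thm 5.2 in the tree's general shifted form
`eq_zero_of_lowDegOn_of_forall_dvd_hwt`): over a field with `3 ≠ 0`, a function of degree `≤ D`, `3D + 2 ≤ n`,
vanishing at every `u ∈ {0,1}ⁿ` with `|u| ≡ r (mod 3)` is zero. -/
theorem eq_zero_of_lowDeg_vanish_class (h3 : (3 : F) ≠ 0) {D : ℕ} (r : ℕ) (hD : 3 * D + 2 ≤ n)
    {f : CubeFn F n} (hf : f ∈ lowDeg F n D) (hvan : ∀ u : Fin n → Bool, wt u % 3 = r % 3 → f u = 0) :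
    f = 0 := by
  have h3' : ((3 : ℕ) : F) ≠ 0 := by exact_mod_cast h3
  rw [lowDeg_eq_lowDegOn] at hf
  refine eq_zero_of_lowDegOn_of_forall_dvd_hwt h3' D (3 - r % 3) (fun ℓ hℓ => ?_) f hf (fun x hx => ?_)
  · refine ⟨ℓ + (3 - (ℓ + (3 - r % 3)) % 3) % 3, ?_, ?_, ?_⟩
    · omega
    · omega
    · rw [Fintype.card_fin]
      omega
  · have hw : hwt x = wt x := rfl
    rw [hw] at hx
    exact hvan x (by omega)

/-- A point of the cube in a prescribed weight class mod 3 (needs `2 ≤ n`). -/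
theorem exists_wt_mod_eq (hn : 2 ≤ n) (r : ℕ) : ∃ u : Fin n → Bool, wt u % 3 = r % 3 := by
  obtain ⟨S, -, hS⟩ := Finset.exists_subset_card_eq (s := (univ : Finset (Fin n))) (n := r % 3)
    (by rw [Finset.card_univ, Fintype.card_fin]; omega)
  refine ⟨indVec S, ?_⟩
  have hw : wt (indVec S) = hwt (indVec S) := rfl
  rw [hw, hwt_indVec, hS]
  omega

/-- **No low-degree avoiding cover.** Over a field with `3 ≠ 0` and `3D + 2 ≤ n` there are no three functions
`z₀, z₁, z₂` of degree `≤ D` on `{0,1}ⁿ` such that `z_s` vanishes on the weight class `r_s (mod 3)` and at every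
point some `z_s` equals `1`: by the immunity of a weight class each `z_s` is identically zero. -/
theorem no_lowDeg_avoiding_cover (h3 : (3 : F) ≠ 0) {D : ℕ} (hD : 3 * D + 2 ≤ n)
    (z : Fin 3 → CubeFn F n) (r : Fin 3 → ℕ) (hz : ∀ s, z s ∈ lowDeg F n D)
    (havoid : ∀ s (u : Fin n → Bool), wt u % 3 = r s % 3 → z s u = 0)
    (hcover : ∀ u : Fin n → Bool, ∃ s, z s u = 1) : False := by
  obtain ⟨u, -⟩ := exists_wt_mod_eq (n := n) (by omega) 0
  obtain ⟨s, hs⟩ := hcover u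
  have hz0 : z s = 0 := eq_zero_of_lowDeg_vanish_class h3 (r s) hD (hz s) (havoid s)
  rw [hz0, Pi.zero_apply] at hs
  exact zero_ne_one hs

end Immunity

/-! ### §2 The three parities of a strategy -/

section Parities

variable {n : ℕ}

/-- `offPhase y s u` = the number of FIRED cuts `g` (`y_g(u) = 1`) whose prefix phase `g + W_g(u)` is
`≢ s (mod 3)`. -/
def offPhase (y : Fin (n + 1) → (Fin n → Bool) → Bool) (s : ℕ) (u : Fin n → Bool) : ℕ :=
  (univ.filter fun g : Fin (n + 1) => y g u = true ∧ (g.val + wtPrefix u g.val) % 3 ≠ s % 3).card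

/-- The PHASE-PARITY statistic: `phaseParEven y s u = [offPhase y s u is even]`. -/
def phaseParEven (y : Fin (n + 1) → (Fin n → Bool) → Bool) (s : ℕ) (u : Fin n → Bool) : Bool :=
  decide (offPhase y s u % 2 = 0)

/-- `offPhase` only depends on `s mod 3`. -/
theorem offPhase_mod (y : Fin (n + 1) → (Fin n → Bool) → Bool) (s : ℕ) (u : Fin n → Bool) :
    offPhase y (s % 3) u = offPhase y s u := by
  unfold offPhase
  simp only [Nat.mod_mod]

/-- **Win ⟺ an odd number of fired cuts off the dead phase.** Cut `g` is live at `u` iff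
`g + W_g(u) ≢ -(c + |u|) (mod 3)`, so `ringWinU c y u` holds iff `offPhase y s† u` is odd for
`s† = 3 - (c + |u|) % 3`. -/
theorem ringWinU_iff_offPhase_odd (c : ℕ) (y : Fin (n + 1) → (Fin n → Bool) → Bool) (u : Fin n → Bool) :
    ringWinU c y u = true ↔ offPhase y (3 - (c + wt u) % 3) u % 2 = 1 := by
  unfold ringWinU offPhase walkExp
  rw [decide_eq_true_eq]
  have hset : (univ.filter fun g : Fin (n + 1) =>
        y g u = true ∧ (c + g.val + (wt u + wtPrefix u g.val)) % 3 ≠ 0) =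
      (univ.filter fun g : Fin (n + 1) =>
        y g u = true ∧ (g.val + wtPrefix u g.val) % 3 ≠ (3 - (c + wt u) % 3) % 3) := by
    refine Finset.filter_congr fun g _ => ?_
    refine and_congr_right fun _ => ?_
    constructor <;> intro h <;> omega
  rw [hset]

/-- **The three parities**: for EVERY strategy and input, `offPhase y 0 u`, `offPhase y 1 u`, `offPhase y 2 u`
are not all odd (their sum is twice the number of fired cuts). -/
theorem exists_offPhase_even (y : Fin (n + 1) → (Fin n → Bool) → Bool) (u : Fin n → Bool) :
    ∃ s : Fin 3, offPhase y s.val u % 2 = 0 := by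
  -- the fired set and its three phase classes
  set T : Finset (Fin (n + 1)) := univ.filter fun g : Fin (n + 1) => y g u = true with hT
  set ph : Fin (n + 1) → ℕ := fun g => (g.val + wtPrefix u g.val) % 3 with hph
  have hfib : T.card = ∑ s ∈ range 3, (T.filter fun g => ph g = s).card :=
    Finset.card_eq_sum_card_fiberwise fun g _ =>
      Finset.mem_coe.2 (Finset.mem_range.2 (Nat.mod_lt _ (by norm_num)))
  have hoff : ∀ s : ℕ, s < 3 → offPhase y s u + (T.filter fun g => ph g = s).card = T.card := by
    intro s hs
    have hs' : s % 3 = s := Nat.mod_eq_of_lt hs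
    have h1 : (univ.filter fun g : Fin (n + 1) => y g u = true ∧ (g.val + wtPrefix u g.val) % 3 ≠ s % 3) =
        T.filter fun g => ¬ (ph g = s) := by
      ext g
      simp only [hT, hph, Finset.mem_filter, Finset.mem_univ, true_and, hs']
    unfold offPhase
    rw [h1, add_comm]
    exact Finset.card_filter_add_card_filter_not (fun g => ph g = s)
  rw [Finset.sum_range_succ, Finset.sum_range_succ, Finset.sum_range_succ, Finset.sum_range_zero,
    zero_add] at hfib
  have e0 := hoff 0 (by norm_num)
  have e1 := hoff 1 (by norm_num)
  have e2 := hoff 2 (by norm_num)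
  by_contra hall
  push Not at hall
  have a0 := hall 0
  have a1 := hall 1
  have a2 := hall 2
  simp only [Fin.val_zero, Fin.val_one, Fin.val_two] at a0 a1 a2
  omega

end Parities

/-! ### §3 The phase-parity law for perfect strategies -/

section Law

variable {n : ℕ}

/-- `3 ≠ 0` in `𝔽_p` for a prime `p ≠ 3`. -/
theorem three_ne_zero_zmod_of_ne (p : ℕ) [hp : Fact p.Prime] (hp3 : p ≠ 3) : (3 : ZMod p) ≠ 0 := by
  intro h
  have h' : ((3 : ℕ) : ZMod p) = 0 := by exact_mod_cast h
  rw [ZMod.natCast_eq_zero_iff] at h'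
  exact hp3 ((Nat.prime_dvd_prime_iff_eq hp.out Nat.prime_three).1 h')

/-- A perfect strategy's `Z_s = {phaseParEven y s}` avoids the weight class `-(c + s) (mod 3)`. -/
theorem phaseParEven_false_of_perfect (c : ℕ) (y : Fin (n + 1) → (Fin n → Bool) → Bool)
    (hperf : ∀ u, ringWinU c y u = true) (s : ℕ) (u : Fin n → Bool)
    (hu : wt u % 3 = (3 - (c % 3 + s % 3) % 3) % 3) : phaseParEven y s u = false := by
  have hw := (ringWinU_iff_offPhase_odd c y u).1 (hperf u)
  have hs : (3 - (c + wt u) % 3) % 3 = s % 3 := by omega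
  rw [← offPhase_mod, hs, offPhase_mod] at hw
  unfold phaseParEven
  rw [decide_eq_false_iff_not]
  omega

/-- **THE PHASE-PARITY LAW (general field).** Over any field `F` with `3 ≠ 0`: if `y` wins the u-walk game at
EVERY input of the board `(n, c)` and `3D + 2 ≤ n`, then for some `s ∈ {0,1,2}` the indicator of
`{u : offPhase y s u even}` is not of degree `≤ D`. -/
theorem perfect_phaseParity_not_lowDeg {F : Type*} [Field F] (h3 : (3 : F) ≠ 0) {D : ℕ}
    (hD : 3 * D + 2 ≤ n) (c : ℕ) (y : Fin (n + 1) → (Fin n → Bool) → Bool)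
    (hperf : ∀ u, ringWinU c y u = true) :
    ∃ s : Fin 3, (fun u => if phaseParEven y s.val u then (1 : F) else 0) ∉ lowDeg F n D := by
  by_contra hall
  push Not at hall
  refine no_lowDeg_avoiding_cover h3 hD (fun s u => if phaseParEven y s.val u then (1 : F) else 0)
    (fun s => (3 - (c % 3 + s.val % 3) % 3) % 3) hall (fun s u hu => ?_) (fun u => ?_)
  · have hf := phaseParEven_false_of_perfect c y hperf s.val u (by omega)
    simp [hf]
  · obtain ⟨s, hs⟩ := exists_offPhase_even y u
    refine ⟨s, ?_⟩
    have ht : phaseParEven y s.val u = true := by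
      unfold phaseParEven
      rw [decide_eq_true_eq]
      exact hs
    simp [ht]

/-- **THE PHASE-PARITY LAW (`𝔽_p`, every prime `p ≠ 3`).** If `y` wins the u-walk game at every input of the
board `(n, c)` and `3D + 2 ≤ n`, then some phase-parity statistic `phaseParEven y s` (`s ∈ {0,1,2}`) does NOT
have `𝔽_p`-degree `≤ D` — with no hypothesis on the degrees of the `y_g` themselves. -/
theorem perfect_phaseParity_degree (p : ℕ) [Fact p.Prime] (hp3 : p ≠ 3) {D : ℕ} (hD : 3 * D + 2 ≤ n)
    (c : ℕ) (y : Fin (n + 1) → (Fin n → Bool) → Bool) (hperf : ∀ u, ringWinU c y u = true) :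
    ∃ s : Fin 3, ¬ HasDegF p (phaseParEven y s.val) D :=
  perfect_phaseParity_not_lowDeg (three_ne_zero_zmod_of_ne p hp3) hD c y hperf

/-- The law in the contrapositive shape used by the residual: a strategy all of whose three phase-parity
statistics have `𝔽_p`-degree `≤ (n - 2)/3` LOSES somewhere. -/
theorem exists_loss_of_phaseParity_lowDeg (p : ℕ) [Fact p.Prime] (hp3 : p ≠ 3) {D : ℕ}
    (hD : 3 * D + 2 ≤ n) (c : ℕ) (y : Fin (n + 1) → (Fin n → Bool) → Bool)
    (hdeg : ∀ s : Fin 3, HasDegF p (phaseParEven y s.val) D) : ∃ u, ringWinU c y u = false := by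
  by_contra hno
  push Not at hno
  have hperf : ∀ u, ringWinU c y u = true := fun u => by
    cases h : ringWinU c y u
    · exact absurd h (hno u)
    · rfl
  obtain ⟨s, hs⟩ := perfect_phaseParity_degree p hp3 hD c y hperf
  exact hs (hdeg s)

end Law

end Summit.QuantumAdvantage.QuantumAdvantage.Theorems.PhaseParity

end
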